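import Summits.QuantumFields.BalabanUV.Beta.EriceRemainderEnclosureHistoryAutonomyComparisonAgeCompositionLevelGaugePrep

/-!
# EriceRemainderEnclosureHistoryAutonomyComparisonAgeCompositionDampedLevelGaugePrep — (E117a) route (N), first order, DAMPED: PREPARATIONS FOR THE EVERY-RANGE
# END OF THE DAMPED SYSTEM ((E117b) `…AgeCompositionDampedLevelGauge`).  The DAMPED kernel of `HOME/b2b-balaban-beta-d4-p2/g62/e71/README.md` (the tree's
# (E72∕CriteriaFlow) convention): the age `k` reads the cell `n+1+l` (`l < k`) at the pin `n` with the weight `L_kh(n+k)³∕2 · Π_{t=n+1+l}^{n+k} g_t`, dampings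
# `0 < g ≤ 1`.  This is NOT a tail-sum kernel in the sense of (E115d) (the weight depends on the lag), so the differenced identity is re-derived for a GENERAL
# kernel: **`sol_step_eq_general`** — `v m = Δe + (1 − K(m,0))·v(m+1) + Σ_{j<N−1} (K(m+1,j) − K(m,j+1))·v(m+2+j) + K(m+1,N−1)·v(m+1+N)`.  For the damped kernel
# the coefficient of an interior cell of the age `k` is `Π g·(c_{m+1,k}·g_{m+k+1} − c_{m,k}) ≥ −(c_{m,k} − c_{m+1,k}·g_{m+k+1})` (**`damped_coeff_ge`**): the
# heating coefficient of the undamped system plus the DAMPING DEFECT `c_{m+1,k}(1 − g_{m+k+1})`, and the outflow cell's coefficient is `≥ 0`.  Under the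
# hypothesis **`1 − g_t ≤ F(t) := Σ_{1≤k<K} L_kh(t+k)³∕2`** (satisfied by the self-consistent pin damping `g = 1∕(1+f)`, `f_t = Σ_k c_{t,k}Πg ≤ F(t)`), the defect
# is paid from the budget too: **`flow_first_entry_le`** (`F(t) ≤ (18∕25)·Δa_{t+1}∕a_{t+1}`), and the per-age cost of the level-gauge row induction stays below
# the share over the level: **`damped_age_budget_poly`** (`(5∕8)AB + (3∕8)(A−B)(A+B+M) + (9∕25)(A² − (2∕3)AB) ≤ A²` for `B ≤ A`, `0 ≤ 2M ≤ A`) and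
# **`flow_damped_age_ge_two_le`** (first entry + (decay + damping defect) × interior window ≤ share∕level, per unit of `ε(m+1)`).
# README `HOME/b2b-balaban-beta-d4-p2/g97/README.md` §4–§5.

Cell `pub-balaban`, β-function sub-cell, BINDER row D4 «RemainderConst leaves for Bałaban's split» (`HOME/BINDER-OWNERS.md`; owner lineage `b2b-balaban-beta-an4`;
this file by co-owner #2 lineage `b2b-balaban-beta-d4-p2`, generation 97), β-FLOW TEAM duty (1), FREEZE (0) honoured (def-free; imports (E116c) `…LevelGaugePrep`;
uses its `stieltjes_sum_le` ∕ `flow_lev_mono` ∕ `flow_two_incr_le_lev` ∕ `flow_incr_le_lev`, (E116b) `flow_rate_decay_le` ∕ `flow_budget_le`, (E58b) `increment_anti`,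
(E48a) `strictAnti_of_memFlow` BY NAME; nothing restated).

HONEST FRAMING (page 1, verbatim and binding).  *"Discharging BetaPertH makes Bałaban's UV stability UNCONDITIONAL — a real constructive-QFT result; it is
NOT the continuum limit and NOT the Clay problem."*  THIS FILE DISCHARGES NOTHING OF THE KIND.  Elementary real analysis about ABSTRACT functionals on a box
]0,γ]^ℕ with displayed floors, profiles, dampings and signs — hypotheses of a census, not facts; the form, signs, ages and moments of Bałaban's (1.22) limit
functional are NOT PRINTED ([I] p. 298; GAPS G-t4-U2-1∕-2) and NOT asserted.  Row D4 class UNCHANGED (critical-path width 0; instance 0∕1; D4 DISCHARGE NO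
DATE).  HONEST DEPENDENCY: continuum YM on T⁴ ⇐ BetaPertH ∧ nine spine estimates (0/9 proved); BetaPertH ⇐ (D1) ∧ (D4) ∧ CAP+tail; G-an2-4 gates asym, D1
and NE2/3/4.  NOT CLAIMED: anything printed — NOT B12 Thm 2, NOT BetaPertH, NOT continuum, NOT Clay.

WHAT IS PROVED ([folklore]; 0 `def`, 0 sorry).  §1 **`sol_step_eq_general`**.  §2 `prod_damping_mem`, **`damped_coeff_ge`**.  §3 **`damped_age_budget_poly`**,
`defect_alg1`–`defect_alg3`, **`flow_first_entry_le`**, **`flow_damped_age_ge_two_le`** (the age `1` has no interior window: (E116c) `flow_age_one_le` serves verbatim).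
-/
noncomputable section
open Finset

namespace Summit.QuantumFields.BalabanUV.Beta.EriceRemainderEnclosureHistoryAutonomyComparisonAgeCompositionDampedLevelGaugePrep

open Literature.MathematicalPhysics.QuantumFieldTheory.Balaban1983to89
open Literature.MathematicalPhysics.QuantumFieldTheory.Balaban1983to89.T4BetaStationary
open Literature.MathematicalPhysics.QuantumFieldTheory.Balaban1983to89.T4BetaFlowWellPosed
open Summit.QuantumFields.BalabanUV.Beta.EriceRemainderEnclosureHistoryAutonomyComparisonAgeCompositionHeatingCriterionFlow (flow_rate_decay_le flow_budget_le)
open Summit.QuantumFields.BalabanUV.Beta.EriceRemainderEnclosureHistoryAutonomyComparisonAgeCompositionLevelGaugePrep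
  (stieltjes_sum_le flow_lev_mono flow_incr_le_lev flow_two_incr_le_lev)
open Summit.QuantumFields.BalabanUV.Beta.EriceRemainderEnclosureHistoryAutonomyComparisonAffineProfile (increment_anti)
open Summit.QuantumFields.BalabanUV.Beta.EriceRemainderEnclosureHistoryAutonomyOrder (strictAnti_of_memFlow)

/-! ## §1 The differenced row identity for a general kernel -/

/-- **THE DIFFERENCED ROW IDENTITY, GENERAL KERNEL.**  Reads `R u m = Σ_{l<N} K(m,l)·u(m+1+l)` with ANY kernel `K`, `N ≥ 1`, and any sequence with
`v m = e m − R v m` at every depth.  Then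
`v m = (e m − e(m+1)) + (1 − K(m,0))·v(m+1) + Σ_{j<N−1} (K(m+1,j) − K(m,j+1))·v(m+2+j) + K(m+1,N−1)·v(m+1+N)`:
each cell below `m+1` is read at the lag `j` from `m+1` and at the lag `j+1` from `m`. [folklore] -/
theorem sol_step_eq_general {N : ℕ} (hN : 1 ≤ N) {K : ℕ → ℕ → ℝ} {R : (ℕ → ℝ) → ℕ → ℝ}
    (hR : ∀ u m, R u m = ∑ l ∈ range N, K m l * u (m + 1 + l)) {e v : ℕ → ℝ} (hrec : ∀ m, v m = e m - R v m) (m : ℕ) :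
    v m = (e m - e (m + 1)) + (1 - K m 0) * v (m + 1)
      + ∑ j ∈ range (N - 1), (K (m + 1) j - K m (j + 1)) * v (m + 2 + j) + K (m + 1) (N - 1) * v (m + 1 + N) := by
  obtain ⟨M, rfl⟩ : ∃ M, N = M + 1 := ⟨N - 1, by omega⟩
  have h0 := hrec m
  have h1 := hrec (m + 1)
  rw [hR] at h0 h1
  -- reads at m: first lag + the rest
  rw [sum_range_succ'] at h0
  -- reads at m+1: last lag + the rest
  rw [sum_range_succ] at h1
  simp only [Nat.add_sub_cancel]
  have e0 : ∑ j ∈ range M, K m (j + 1) * v (m + 1 + (j + 1)) = ∑ j ∈ range M, K m (j + 1) * v (m + 2 + j) :=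
    sum_congr rfl fun j _ => by rw [show m + 1 + (j + 1) = m + 2 + j by ring]
  have e1 : ∑ j ∈ range M, K (m + 1) j * v (m + 1 + 1 + j) = ∑ j ∈ range M, K (m + 1) j * v (m + 2 + j) :=
    sum_congr rfl fun j _ => by rw [show m + 1 + 1 + j = m + 2 + j by ring]
  rw [e0, add_zero] at h0
  rw [e1, show m + 1 + 1 + M = m + 1 + (M + 1) by ring] at h1
  have e2 : ∑ j ∈ range M, (K (m + 1) j - K m (j + 1)) * v (m + 2 + j)
      = ∑ j ∈ range M, K (m + 1) j * v (m + 2 + j) - ∑ j ∈ range M, K m (j + 1) * v (m + 2 + j) := by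
    rw [← sum_sub_distrib]; exact sum_congr rfl fun j _ => by ring
  rw [e2]
  linarith

/-! ## §2 The damped kernel: the coefficients of the identity -/

/-- A product of dampings `0 < g ≤ 1` lies in `(0, 1]`. [folklore] -/
theorem prod_damping_mem {g : ℕ → ℝ} (hg : ∀ t, 0 < g t ∧ g t ≤ 1) (s : Finset ℕ) :
    0 < ∏ t ∈ s, g t ∧ ∏ t ∈ s, g t ≤ 1 :=
  ⟨prod_pos fun t _ => (hg t).1, prod_le_one (fun t _ => (hg t).1.le) fun t _ => (hg t).2⟩

/-- **THE COEFFICIENTS OF THE DAMPED AGE.**  Damped lone kernel of the age `k`: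
`KD n l = [k ∈ O ∧ k < K ∧ l < k]·(L_kh(n+k)³∕2)·Π_{t∈[n+1+l, n+k]} g_t`, `0 < g ≤ 1`, `L_k ≥ 0`, `h > 0` non-increasing.  Then for every `j`:
`KD (m+1) j − KD m (j+1) ≥ −[k ∈ O ∧ k < K ∧ j+1 < k]·(L_kh(m+k)³∕2 − (L_kh(m+1+k)³∕2)·g(m+k+1))` — an interior cell carries the damped heating coefficient
`Πg·(c_{m+1,k}g_{m+k+1} − c_{m,k}) ≥ −(c_{m,k} − c_{m+1,k}g_{m+k+1})`, the outflow cell `j+1 = k` carries `c_{m+1,k}·g ≥ 0`, deeper cells carry `0`. [folklore] -/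
theorem damped_coeff_ge {L h g : ℕ → ℝ} {K : ℕ} {O : Finset ℕ} (hL : ∀ k, 0 ≤ L k) (hh0 : ∀ n, 0 < h n) (hanti : Antitone h)
    (hg : ∀ t, 0 < g t ∧ g t ≤ 1) {k : ℕ} {KD : ℕ → ℕ → ℝ}
    (hKD : ∀ n l, KD n l = if k ∈ O ∧ k < K ∧ l < k then L k * h (n + k) ^ 3 / 2 * ∏ t ∈ Ico (n + 1 + l) (n + k + 1), g t else 0) (m j : ℕ) :
    -(if k ∈ O ∧ k < K ∧ j + 1 < k then L k * h (m + k) ^ 3 / 2 - L k * h (m + 1 + k) ^ 3 / 2 * g (m + k + 1) else 0)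
      ≤ KD (m + 1) j - KD m (j + 1) := by
  have hc0 : ∀ n, 0 ≤ L k * h (n + k) ^ 3 / 2 := fun n => by have := hL k; have := hh0 (n + k); positivity
  have hc' : L k * h (m + 1 + k) ^ 3 / 2 ≤ L k * h (m + k) ^ 3 / 2 := by
    have := pow_le_pow_left₀ (hh0 _).le (hanti (by omega : m + k ≤ m + 1 + k)) 3
    have := hL k; nlinarith
  have hcg : L k * h (m + 1 + k) ^ 3 / 2 * g (m + k + 1) ≤ L k * h (m + k) ^ 3 / 2 := by
    calc L k * h (m + 1 + k) ^ 3 / 2 * g (m + k + 1) ≤ L k * h (m + 1 + k) ^ 3 / 2 * 1 :=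
          mul_le_mul_of_nonneg_left (hg _).2 (hc0 _)
      _ ≤ L k * h (m + k) ^ 3 / 2 := by rw [mul_one]; exact hc'
  rw [hKD, hKD]
  split_ifs with h1 h2
  · -- interior cell: both windows read it
    have hsplit : ∏ t ∈ Ico (m + 1 + 1 + j) (m + 1 + k + 1), g t = (∏ t ∈ Ico (m + 1 + (j + 1)) (m + k + 1), g t) * g (m + k + 1) := by
      rw [show m + 1 + 1 + j = m + 1 + (j + 1) by ring, show m + 1 + k + 1 = m + k + 1 + 1 by ring, prod_Ico_succ_top (by omega)]
    rw [hsplit]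
    obtain ⟨_, hP1⟩ := prod_damping_mem hg (Ico (m + 1 + (j + 1)) (m + k + 1))
    have key : (1 : ℝ) * (L k * h (m + 1 + k) ^ 3 / 2 * g (m + k + 1) - L k * h (m + k) ^ 3 / 2)
        ≤ (∏ t ∈ Ico (m + 1 + (j + 1)) (m + k + 1), g t) * (L k * h (m + 1 + k) ^ 3 / 2 * g (m + k + 1) - L k * h (m + k) ^ 3 / 2) :=
      mul_le_mul_of_nonpos_right hP1 (by linarith)
    nlinarith
  · exact (h2 ⟨h1.1, h1.2.1, by have := h1.2.2; omega⟩).elim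
  · -- outflow cell
    rw [neg_zero, sub_zero]
    exact mul_nonneg (hc0 _) (prod_damping_mem hg _).1.le
  · simp

/-! ## §3 The per-age cost with the damping defect, along the flow -/

/-- **THE DAMPED PER-AGE BUDGET POLYNOMIAL.**  `B ≤ A`, `0 ≤ M`, `2M ≤ A` ⟹
`(5∕8)AB + (3∕8)(A−B)(A+B+M) + (9∕25)(A² − (2∕3)AB) ≤ A²` (first entry + heating + damping defect per unit of budget share). [folklore] -/
theorem damped_age_budget_poly {A B M : ℝ} (hBA : B ≤ A) (hM0 : 0 ≤ M) (hM : 2 * M ≤ A) :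
    5 / 8 * A * B + 3 / 8 * (A - B) * (A + B + M) + 9 / 25 * (A ^ 2 - 2 / 3 * A * B) ≤ A ^ 2 := by
  have h1 : 3 / 8 * (A - B) * (A + B + M) ≤ 3 / 8 * (A - B) * (A + B + A / 2) := by
    have := mul_le_mul_of_nonneg_left (by linarith : A + B + M ≤ A + B + A / 2) (by linarith : 0 ≤ 3 / 8 * (A - B))
    linarith
  have h0M : 0 ≤ M := hM0
  nlinarith [sq_nonneg (A - 2 * B), sq_nonneg B]

variable {B : (ℕ → ℝ) → ℝ} {γ b gIR : ℝ} {L : ℕ → ℝ} {K : ℕ} {h : ℕ → ℝ}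

/-- **THE FIRST ENTRY IS AT MOST `18∕25` OF THE RELATIVE LEVEL STEP**: `F(t) := Σ_{1≤k<K} L_kh(t+k)³∕2 ≤ (18∕25)·(1∕h(t+1)² − 1∕h(t)²)·h(t+1)²` — each rate is its
next-row share `L_kh(t+1+k)` times `h(t+k)³∕(2h(t+1+k)) ≤ (36∕25)∕(2a_{t+k})` (`a_{t+1+k} ≤ 2a_{t+k}`), and `a_{t+k} ≥ a_{t+1}`. [folklore] -/
theorem flow_first_entry_le (hmono : ∀ u v : ℕ → ℝ, SeqBox γ u → SeqBox γ v → (∀ j, u j ≤ v j) → B u ≤ B v) (hL : ∀ k, 0 ≤ L k) (hb : 0 < b)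
    (hlo : ∀ u, SeqBox γ u → b ≤ B u) (hdom : ∀ u, SeqBox γ u → ∑ k ∈ range K, L k * u k ≤ B u) (hh : SeqBox γ h) (hf : MemFlow B gIR h) (t : ℕ) :
    ∑ k ∈ Ico 1 K, L k * h (t + k) ^ 3 / 2 ≤ 18 / 25 * (1 / h (t + 1) ^ 2 - 1 / h t ^ 2) * h (t + 1) ^ 2 := by
  have hpos : ∀ j, 0 < h j := fun j => (hh j).1
  have hanti := (strictAnti_of_memFlow hb hlo hh hf).antitone
  have ht1 := hpos (t + 1)
  -- per age: L h(t+k)³/2 ≤ (18/25) L h(t+1+k) h(t+1)²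
  have hage : ∀ k ∈ Ico 1 K, L k * h (t + k) ^ 3 / 2 ≤ 18 / 25 * (L k * h (t + 1 + k)) * h (t + 1) ^ 2 := by
    intro k hk
    have hk1 : 1 ≤ k := (mem_Ico.mp hk).1
    have h0 := hpos (t + k); have h1 := hpos (t + 1 + k)
    -- a_{t+1+k} ≤ 2 a_{t+k}  ⟹  h(t+k) ≤ (36/25) h(t+1+k)
    have hincr := flow_incr_le_lev hmono hb hlo hh hf (t + k) (p := t + k) (by omega)
    rw [show t + k + 1 = t + 1 + k by ring] at hincr
    have hsq : h (t + k) ^ 2 ≤ (36 / 25 * h (t + 1 + k)) ^ 2 := by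
      rw [mul_pow]
      have e : 1 / h (t + 1 + k) ^ 2 * (h (t + k) ^ 2 * h (t + 1 + k) ^ 2) = h (t + k) ^ 2 := by field_simp
      have e' : 2 * (1 / h (t + k) ^ 2) * (h (t + k) ^ 2 * h (t + 1 + k) ^ 2) = 2 * h (t + 1 + k) ^ 2 := by field_simp
      have hq : 0 < 1 / h (t + k) ^ 2 := by positivity
      have hlev : 1 / h (t + 1 + k) ^ 2 ≤ 2 * (1 / h (t + k) ^ 2) := by linarith
      have := mul_le_mul_of_nonneg_right hlev (by positivity : 0 ≤ h (t + k) ^ 2 * h (t + 1 + k) ^ 2)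
      rw [e, e'] at this
      nlinarith
    have hratio : h (t + k) ≤ 36 / 25 * h (t + 1 + k) := (pow_le_pow_iff_left₀ h0.le (by positivity) two_ne_zero).1 hsq
    -- h(t+k) ≤ h(t+1)
    have hmon : h (t + k) ≤ h (t + 1) := hanti (by omega)
    have hLk := hL k
    -- L h(t+k)³/2 = (L/2) h(t+k) · h(t+k)² ≤ (L/2)(36/25) h(t+1+k) · h(t+1)²
    have h2 : h (t + k) ^ 2 ≤ h (t + 1) ^ 2 := pow_le_pow_left₀ h0.le hmon 2
    calc L k * h (t + k) ^ 3 / 2 = L k / 2 * h (t + k) * h (t + k) ^ 2 := by ring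
      _ ≤ L k / 2 * (36 / 25 * h (t + 1 + k)) * h (t + 1) ^ 2 := by
          apply mul_le_mul (mul_le_mul_of_nonneg_left hratio (by positivity)) h2 (by positivity) (by positivity)
      _ = 18 / 25 * (L k * h (t + 1 + k)) * h (t + 1) ^ 2 := by ring
  have hsum := sum_le_sum hage
  rw [← sum_mul, ← mul_sum] at hsum
  refine hsum.trans ?_
  have hbud := flow_budget_le hdom hh hf t
  have hsub : ∑ k ∈ Ico 1 K, L k * h (t + 1 + k) ≤ ∑ k ∈ range K, L k * h (t + 1 + k) :=
    sum_le_sum_of_subset_of_nonneg (fun k hk => mem_range.mpr (mem_Ico.mp hk).2) fun k _ _ => mul_nonneg (hL k) (hpos _).le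
  have := hsub.trans hbud
  have ht12 : 0 ≤ h (t + 1) ^ 2 := (pow_pos ht1 2).le
  nlinarith [mul_le_mul_of_nonneg_right this ht12]

/-- Algebra of the defect term (letters free). [folklore] -/
theorem defect_alg1 {β A' D2 A'' ε1 Bl j A : ℝ} (hA' : A' ≠ 0) (hA'' : A'' ≠ 0) (hBl : Bl ≠ 0) :
    (β * (1 / A') / 2 * (18 / 25 * D2 * (1 / A''))) * (ε1 * (1 / Bl) * (j * A))
      = 9 / 25 * β * ε1 * (A / (A' * A'' * Bl)) * (j * D2) := by
  field_simp
  ring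

/-- Algebra of the defect term, second step (letters free). [folklore] -/
theorem defect_alg2 {β A A' A'' ε1 Bl : ℝ} (hA : A ≠ 0) (hA' : A' ≠ 0) (hA'' : A'' ≠ 0) (hBl : Bl ≠ 0) :
    9 / 25 * β * ε1 * (A - 2 / 3 * Bl) / (A * Bl) - 9 / 25 * β * ε1 * (A / (A' * A'' * Bl)) * (A' - Bl)
      = 9 / 25 * β * ε1 * (A' * A'' * (A - 2 / 3 * Bl) - A * A * (A' - Bl)) / (A * A' * A'' * Bl) := by
  field_simp

/-- Algebra of the assembled per-age cost (letters free). [folklore] -/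
theorem defect_alg3 {β A Bl M ε1 : ℝ} (hA : A ≠ 0) (hBl : Bl ≠ 0) :
    β * (1 / Bl) * ε1 - (5 / 8 * β / A * ε1 + 3 / 4 * β * (1 / A ^ 2) * (ε1 * (1 / Bl) * ((A - Bl) * (A + Bl + M) / 2))
        + 9 / 25 * β * ε1 * (A - 2 / 3 * Bl) / (A * Bl))
      = β * ε1 * (A ^ 2 - (5 / 8 * A * Bl + 3 / 8 * (A - Bl) * (A + Bl + M) + 9 / 25 * (A ^ 2 - 2 / 3 * A * Bl))) / (A ^ 2 * Bl) := by
  field_simp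
  ring

set_option maxHeartbeats 800000 in
/-- **THE COST OF A DAMPED AGE `k ≥ 2`** at the row `m`, per unit of `ε(m+1)`: FIRST ENTRY + (DECAY + DAMPING DEFECT) × INTERIOR WINDOW ≤ SHARE ∕ LEVEL.  With the
interior window sum bounded through the level gauge, `0 ≤ S ≤ ε1·h(m+1)²·Σ_{l∈[1,k)} 1∕h(m+1+l)²`, `ε1 ≥ 0`, and a damping defect `0 ≤ θ ≤ F(m+k+1)`:
`(L_kh(m+k)³∕2)·ε1 + (L_kh(m+k)³∕2 − L_kh(m+1+k)³∕2 + (L_kh(m+1+k)³∕2)·θ)·S ≤ L_kh(m+1+k)·h(m+1)²·ε1`.  Ingredients of (E116c) `flow_age_ge_two_le` plus the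
defect: `θ ≤ (18∕25)Δa_{m+k+2}∕a_{m+k+2}` (`flow_first_entry_le`), `(k−1)Δa_{m+k+2} ≤ a_{m+k+1} − a_{m+2}`, and `damped_age_budget_poly`. [folklore] -/
theorem flow_damped_age_ge_two_le (hmono : ∀ u v : ℕ → ℝ, SeqBox γ u → SeqBox γ v → (∀ j, u j ≤ v j) → B u ≤ B v) (hL : ∀ k, 0 ≤ L k) (hb : 0 < b)
    (hlo : ∀ u, SeqBox γ u → b ≤ B u) (hdom : ∀ u, SeqBox γ u → ∑ k ∈ range K, L k * u k ≤ B u) (hh : SeqBox γ h) (hf : MemFlow B gIR h)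
    (m : ℕ) {k : ℕ} (hk : 2 ≤ k) {S ε1 θ : ℝ} (hε1 : 0 ≤ ε1) (hS0 : 0 ≤ S) (hS : S ≤ ε1 * h (m + 1) ^ 2 * ∑ l ∈ Ico 1 k, 1 / h (m + 1 + l) ^ 2)
    (hθ0 : 0 ≤ θ) (hθ : θ ≤ ∑ q ∈ Ico 1 K, L q * h (m + k + 1 + q) ^ 3 / 2) :
    L k * h (m + k) ^ 3 / 2 * ε1 + (L k * h (m + k) ^ 3 / 2 - L k * h (m + 1 + k) ^ 3 / 2 + L k * h (m + 1 + k) ^ 3 / 2 * θ) * S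
      ≤ L k * h (m + 1 + k) * h (m + 1) ^ 2 * ε1 := by
  have hpos : ∀ j, 0 < h j := fun j => (hh j).1
  have hanti := (strictAnti_of_memFlow hb hlo hh hf).antitone
  have hLk := hL k
  have h0 := hpos (m + k); have h1 := hpos (m + 1 + k); have hm1 := hpos (m + 1); have h2' := hpos (m + k + 2)
  set A : ℝ := 1 / h (m + k) ^ 2 with hA
  set Bl : ℝ := 1 / h (m + 1) ^ 2 with hBl
  set D : ℝ := 1 / h (m + 1 + k) ^ 2 - 1 / h (m + k) ^ 2 with hD
  set M : ℝ := 1 / h (m + 2) ^ 2 - 1 / h (m + 1) ^ 2 with hM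
  set β : ℝ := L k * h (m + 1 + k) with hβ
  have hA0 : 0 < A := by positivity
  have hBl0 : 0 < Bl := by positivity
  have hβ0 : 0 ≤ β := mul_nonneg hLk h1.le
  have hBA : Bl ≤ A := flow_lev_mono hb hlo hh hf (by omega)
  have hD0 : 0 ≤ D := by have := flow_lev_mono hb hlo hh hf (show m + k ≤ m + 1 + k by omega); simp only [hD]; linarith
  have hM0 : 0 ≤ M := by have := flow_lev_mono hb hlo hh hf (show m + 1 ≤ m + 2 by omega); simp only [hM]; linarith
  have h2D : 2 * D ≤ A := by
    have := flow_two_incr_le_lev hmono hb hlo hh hf (n := m + k) (p := m + k) (by omega) (by omega)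
    rw [show m + k + 1 = m + 1 + k by ring] at this; exact this
  have h2M : 2 * M ≤ A := by
    have h' := flow_two_incr_le_lev hmono hb hlo hh hf (n := m + 1) (p := m + 2) (by omega) (by omega)
    rw [show m + 1 + 1 = m + 2 by ring] at h'
    have := flow_lev_mono hb hlo hh hf (show m + 2 ≤ m + k by omega)
    simp only [hM]; linarith
  -- (p1) first entry ≤ (5/8) β / A
  have hlev : 1 / h (m + 1 + k) ^ 2 ≤ 25 / 16 * (1 / h (m + k) ^ 2) := by
    have : 1 / h (m + 1 + k) ^ 2 = A + D := by simp only [hA, hD]; ring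
    rw [this]; simp only [hA] at h2D ⊢; linarith
  have hratio : h (m + k) ≤ 5 / 4 * h (m + 1 + k) := by
    have hsq : h (m + k) ^ 2 ≤ (5 / 4 * h (m + 1 + k)) ^ 2 := by
      rw [mul_pow]
      have e : 1 / h (m + 1 + k) ^ 2 * (h (m + k) ^ 2 * h (m + 1 + k) ^ 2) = h (m + k) ^ 2 := by field_simp
      have e' : 25 / 16 * (1 / h (m + k) ^ 2) * (h (m + k) ^ 2 * h (m + 1 + k) ^ 2) = (5 / 4) ^ 2 * h (m + 1 + k) ^ 2 := by
        field_simp; ring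
      have := mul_le_mul_of_nonneg_right hlev (by positivity : 0 ≤ h (m + k) ^ 2 * h (m + 1 + k) ^ 2)
      rw [e, e'] at this; exact this
    exact (pow_le_pow_iff_left₀ h0.le (by positivity) two_ne_zero).1 hsq
  have hp1 : L k * h (m + k) ^ 3 / 2 ≤ 5 / 8 * β / A := by
    have e : 5 / 8 * β / A = 5 / 8 * (L k * h (m + 1 + k)) * h (m + k) ^ 2 := by simp only [hβ, hA]; field_simp
    rw [e]
    nlinarith [mul_nonneg hLk (mul_nonneg (pow_pos h0 2).le (by linarith : 0 ≤ 5 / 4 * h (m + 1 + k) - h (m + k)))]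
  -- (p2) decay ≤ (3/4) β D / A²
  have hp2 : L k * h (m + k) ^ 3 / 2 - L k * h (m + 1 + k) ^ 3 / 2 ≤ 3 / 4 * β * D * h (m + k) ^ 4 :=
    flow_rate_decay_le hL hb hlo hh hf k m
  have hA2 : h (m + k) ^ 4 = 1 / A ^ 2 := by simp only [hA]; field_simp
  -- (p2') damping defect: c' θ ≤ (β/(2 a_{m+1+k})) · (18/25) Δa_{m+k+2} h(m+k+2)²
  have hFle := flow_first_entry_le hmono hL hb hlo hdom hh hf (m + k + 1)
  rw [show m + k + 1 + 1 = m + k + 2 by ring] at hFle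
  set D2 : ℝ := 1 / h (m + k + 2) ^ 2 - 1 / h (m + k + 1) ^ 2 with hD2
  have hD20 : 0 ≤ D2 := by have := flow_lev_mono hb hlo hh hf (show m + k + 1 ≤ m + k + 2 by omega); simp only [hD2]; linarith
  have hθ' : θ ≤ 18 / 25 * D2 * h (m + k + 2) ^ 2 := hθ.trans hFle
  have hc'θ : L k * h (m + 1 + k) ^ 3 / 2 * θ ≤ β * h (m + 1 + k) ^ 2 / 2 * (18 / 25 * D2 * h (m + k + 2) ^ 2) := by
    have e : L k * h (m + 1 + k) ^ 3 / 2 = β * h (m + 1 + k) ^ 2 / 2 := by simp only [hβ]; ring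
    rw [e]; exact mul_le_mul_of_nonneg_left hθ' (by positivity)
  -- (p3)+(p4) Stieltjes: D · Σ_{l∈[1,k)} a_{m+1+l} ≤ (A − Bl)(A + Bl + M)/2, and the cruder (k−1) bounds for the defect
  obtain ⟨j, rfl⟩ : ∃ j, k = j + 1 := ⟨k - 1, by omega⟩
  have hx0 : ∀ l, 0 ≤ 1 / h (m + 1 + l) ^ 2 := fun l => by have := hpos (m + 1 + l); positivity
  have hst := stieltjes_sum_le (x := fun l => 1 / h (m + 1 + l) ^ 2) (D := D) (M := M) hD0 hx0 j
    (fun l hl1 hlj => by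
      obtain ⟨i, rfl⟩ : ∃ i, l = i + 1 := ⟨l - 1, by omega⟩
      simp only [Nat.add_sub_cancel, hD]
      rw [show m + 1 + (i + 1) = (m + 1 + i) + 1 by ring, hf.2 (m + 1 + i),
        show m + 1 + (j + 1) = (m + (j + 1)) + 1 by ring, hf.2 (m + (j + 1))]
      have := increment_anti hmono hb hlo hh hf (show m + 1 + i ≤ m + (j + 1) by omega)
      linarith)
    (fun l hl1 hlj => by
      obtain ⟨i, rfl⟩ : ∃ i, l = i + 1 := ⟨l - 1, by omega⟩
      simp only [Nat.add_sub_cancel, hM]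
      rw [show m + 1 + (i + 1) = (m + 1 + i) + 1 by ring, hf.2 (m + 1 + i), show m + 2 = (m + 1) + 1 by ring, hf.2 (m + 1)]
      have := increment_anti hmono hb hlo hh hf (show m + 1 ≤ m + 1 + i by omega)
      linarith)
  simp only [add_zero] at hst
  rw [show m + 1 + j = m + (j + 1) by ring] at hst
  -- the window sum is also ≤ j · A (each level ≤ A)
  have hsumA : ∑ l ∈ Ico 1 (j + 1), 1 / h (m + 1 + l) ^ 2 ≤ (j : ℝ) * A := by
    calc ∑ l ∈ Ico 1 (j + 1), 1 / h (m + 1 + l) ^ 2 ≤ ∑ l ∈ Ico 1 (j + 1), A :=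
          sum_le_sum fun l hl => flow_lev_mono hb hlo hh hf (by have := (mem_Ico.mp hl).2; omega)
      _ = (j : ℝ) * A := by rw [sum_const, Nat.card_Ico, nsmul_eq_mul]; push_cast; ring
  -- j · D2 ≤ a_{m+1+k} − Bl : the increments at m+3 … m+k+1 are ≥ D2 = Δa_{m+k+2}, and a_{m+2} ≥ Bl
  have key : ∀ q, q ≤ j → (q : ℝ) * D2 ≤ 1 / h (m + 2 + q) ^ 2 - 1 / h (m + 2) ^ 2 := by
    intro q
    induction q with
    | zero => intro _; simp
    | succ q ih =>
      intro hq
      have ih' := ih (by omega)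
      have hstep : D2 ≤ 1 / h (m + 2 + q + 1) ^ 2 - 1 / h (m + 2 + q) ^ 2 := by
        simp only [hD2]
        rw [hf.2 (m + 2 + q), show m + (j + 1) + 2 = (m + (j + 1) + 1) + 1 by ring, hf.2 (m + (j + 1) + 1)]
        have := increment_anti hmono hb hlo hh hf (show m + 2 + q ≤ m + (j + 1) + 1 by omega)
        linarith
      push_cast
      rw [show m + 2 + (q + 1) = m + 2 + q + 1 by ring]
      linarith
  set A' : ℝ := 1 / h (m + 1 + (j + 1)) ^ 2 with hA'
  set A'' : ℝ := 1 / h (m + (j + 1) + 2) ^ 2 with hA''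
  have hA'0 : 0 < A' := by positivity
  have hA''0 : 0 < A'' := by have := hpos (m + (j + 1) + 2); positivity
  have hjD2 : (j : ℝ) * D2 ≤ A' - Bl := by
    have h1' := key j le_rfl
    rw [show m + 2 + j = m + 1 + (j + 1) by ring] at h1'
    have hB2 : Bl ≤ 1 / h (m + 2) ^ 2 := flow_lev_mono hb hlo hh hf (by omega)
    linarith
  have hAA' : A' ≤ 3 / 2 * A := by
    have : A' = A + D := by simp only [hA', hA, hD]; ring
    rw [this]; linarith
  have hA'A'' : A' ≤ A'' := by
    have := flow_lev_mono hb hlo hh hf (show m + 1 + (j + 1) ≤ m + (j + 1) + 2 by omega)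
    simp only [hA', hA'']; exact this
  have hAA'' : A ≤ A'' := (by linarith : A ≤ A').trans hA'A''
  -- the defect term: c'θ·S ≤ (9/25) β ε1 (A/(A'A'')) (A' − Bl) / Bl ≤ (9/25) β ε1 (A − (2/3)Bl)/(A Bl)
  have hm1sq : h (m + 1) ^ 2 = 1 / Bl := by simp only [hBl]; field_simp
  have hk1sq : h (m + 1 + (j + 1)) ^ 2 = 1 / A' := by simp only [hA']; field_simp
  have hk2sq : h (m + (j + 1) + 2) ^ 2 = 1 / A'' := by simp only [hA'']; field_simp
  have hSj : S ≤ ε1 * (1 / Bl) * ((j : ℝ) * A) := by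
    rw [← hm1sq]; exact hS.trans (mul_le_mul_of_nonneg_left hsumA (by positivity))
  have hdef1 : L (j + 1) * h (m + 1 + (j + 1)) ^ 3 / 2 * θ ≤ β * (1 / A') / 2 * (18 / 25 * D2 * (1 / A'')) := by
    rw [← hk1sq, ← hk2sq]; exact hc'θ
  have hdef0 : 0 ≤ L (j + 1) * h (m + 1 + (j + 1)) ^ 3 / 2 * θ := by positivity
  have hdefect : L (j + 1) * h (m + 1 + (j + 1)) ^ 3 / 2 * θ * S ≤ 9 / 25 * β * ε1 * (A - 2 / 3 * Bl) / (A * Bl) := by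
    have s1 : L (j + 1) * h (m + 1 + (j + 1)) ^ 3 / 2 * θ * S
        ≤ (β * (1 / A') / 2 * (18 / 25 * D2 * (1 / A''))) * (ε1 * (1 / Bl) * ((j : ℝ) * A)) := mul_le_mul hdef1 hSj hS0 (by positivity)
    have e1 : (β * (1 / A') / 2 * (18 / 25 * D2 * (1 / A''))) * (ε1 * (1 / Bl) * ((j : ℝ) * A))
        = 9 / 25 * β * ε1 * (A / (A' * A'' * Bl)) * ((j : ℝ) * D2) := defect_alg1 hA'0.ne' hA''0.ne' hBl0.ne'
    rw [e1] at s1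
    have s2 : 9 / 25 * β * ε1 * (A / (A' * A'' * Bl)) * ((j : ℝ) * D2) ≤ 9 / 25 * β * ε1 * (A / (A' * A'' * Bl)) * (A' - Bl) :=
      mul_le_mul_of_nonneg_left hjD2 (by positivity)
    -- (A/(A'A''))(A' − Bl) ≤ (A − (2/3)Bl)/A :  A²(A' − Bl) ≤ A'A''(A − (2/3)Bl)
    have s3 : 9 / 25 * β * ε1 * (A / (A' * A'' * Bl)) * (A' - Bl) ≤ 9 / 25 * β * ε1 * (A - 2 / 3 * Bl) / (A * Bl) := by
      have hineq : A * A * (A' - Bl) ≤ A' * A'' * (A - 2 / 3 * Bl) := by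
        -- A(A' − Bl) ≤ A'(A − (2/3)Bl) since A ≤ A' ≤ (3/2)A; then multiply by A ≤ A''
        have t1 : A * (A' - Bl) ≤ A' * (A - 2 / 3 * Bl) := by
          have := mul_le_mul_of_nonneg_left hAA' hBl0.le
          nlinarith
        have t2 : 0 ≤ A - 2 / 3 * Bl := by linarith
        calc A * A * (A' - Bl) = A * (A * (A' - Bl)) := by ring
          _ ≤ A * (A' * (A - 2 / 3 * Bl)) := mul_le_mul_of_nonneg_left t1 hA0.le
          _ ≤ A'' * (A' * (A - 2 / 3 * Bl)) := mul_le_mul_of_nonneg_right hAA'' (mul_nonneg hA'0.le t2)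
          _ = A' * A'' * (A - 2 / 3 * Bl) := by ring
      have e2 : 9 / 25 * β * ε1 * (A - 2 / 3 * Bl) / (A * Bl) - 9 / 25 * β * ε1 * (A / (A' * A'' * Bl)) * (A' - Bl)
          = 9 / 25 * β * ε1 * (A' * A'' * (A - 2 / 3 * Bl) - A * A * (A' - Bl)) / (A * A' * A'' * Bl) :=
        defect_alg2 hA0.ne' hA'0.ne' hA''0.ne' hBl0.ne'
      have : 0 ≤ 9 / 25 * β * ε1 * (A' * A'' * (A - 2 / 3 * Bl) - A * A * (A' - Bl)) / (A * A' * A'' * Bl) :=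
        div_nonneg (mul_nonneg (by positivity) (by linarith)) (by positivity)
      linarith
    linarith
  -- the undamped parts
  have hDS : D * S ≤ ε1 * (1 / Bl) * ((A - Bl) * (A + Bl + M) / 2) := by
    calc D * S ≤ D * (ε1 * h (m + 1) ^ 2 * ∑ l ∈ Ico 1 (j + 1), 1 / h (m + 1 + l) ^ 2) := mul_le_mul_of_nonneg_left hS hD0
      _ = ε1 * h (m + 1) ^ 2 * (D * ∑ l ∈ Ico 1 (j + 1), 1 / h (m + 1 + l) ^ 2) := by ring
      _ ≤ ε1 * h (m + 1) ^ 2 * ((A - Bl) * (A + Bl + M) / 2) := mul_le_mul_of_nonneg_left hst (by positivity)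
      _ = ε1 * (1 / Bl) * ((A - Bl) * (A + Bl + M) / 2) := by rw [hm1sq]
  have hheat : (L (j + 1) * h (m + (j + 1)) ^ 3 / 2 - L (j + 1) * h (m + 1 + (j + 1)) ^ 3 / 2) * S
      ≤ 3 / 4 * β * (1 / A ^ 2) * (ε1 * (1 / Bl) * ((A - Bl) * (A + Bl + M) / 2)) := by
    calc (L (j + 1) * h (m + (j + 1)) ^ 3 / 2 - L (j + 1) * h (m + 1 + (j + 1)) ^ 3 / 2) * S
        ≤ 3 / 4 * β * D * h (m + (j + 1)) ^ 4 * S := mul_le_mul_of_nonneg_right hp2 hS0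
      _ = 3 / 4 * β * (1 / A ^ 2) * (D * S) := by rw [hA2]; ring
      _ ≤ 3 / 4 * β * (1 / A ^ 2) * (ε1 * (1 / Bl) * ((A - Bl) * (A + Bl + M) / 2)) := mul_le_mul_of_nonneg_left hDS (by positivity)
  have hfirst : L (j + 1) * h (m + (j + 1)) ^ 3 / 2 * ε1 ≤ 5 / 8 * β / A * ε1 := mul_le_mul_of_nonneg_right hp1 hε1
  have hpoly := damped_age_budget_poly hBA hM0 h2M
  have htarget : L (j + 1) * h (m + 1 + (j + 1)) * h (m + 1) ^ 2 * ε1 = β * (1 / Bl) * ε1 := by rw [hm1sq]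
  rw [htarget]
  have hsplit : (L (j + 1) * h (m + (j + 1)) ^ 3 / 2 - L (j + 1) * h (m + 1 + (j + 1)) ^ 3 / 2
        + L (j + 1) * h (m + 1 + (j + 1)) ^ 3 / 2 * θ) * S
      = (L (j + 1) * h (m + (j + 1)) ^ 3 / 2 - L (j + 1) * h (m + 1 + (j + 1)) ^ 3 / 2) * S
        + L (j + 1) * h (m + 1 + (j + 1)) ^ 3 / 2 * θ * S := by ring
  rw [hsplit]
  have hkey : 5 / 8 * β / A * ε1 + 3 / 4 * β * (1 / A ^ 2) * (ε1 * (1 / Bl) * ((A - Bl) * (A + Bl + M) / 2))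
      + 9 / 25 * β * ε1 * (A - 2 / 3 * Bl) / (A * Bl) ≤ β * (1 / Bl) * ε1 := by
    have e : β * (1 / Bl) * ε1 - (5 / 8 * β / A * ε1 + 3 / 4 * β * (1 / A ^ 2) * (ε1 * (1 / Bl) * ((A - Bl) * (A + Bl + M) / 2))
        + 9 / 25 * β * ε1 * (A - 2 / 3 * Bl) / (A * Bl))
        = β * ε1 * (A ^ 2 - (5 / 8 * A * Bl + 3 / 8 * (A - Bl) * (A + Bl + M) + 9 / 25 * (A ^ 2 - 2 / 3 * A * Bl))) / (A ^ 2 * Bl) :=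
      defect_alg3 hA0.ne' hBl0.ne'
    have : 0 ≤ β * ε1 * (A ^ 2 - (5 / 8 * A * Bl + 3 / 8 * (A - Bl) * (A + Bl + M) + 9 / 25 * (A ^ 2 - 2 / 3 * A * Bl))) / (A ^ 2 * Bl) := by
      apply div_nonneg _ (by positivity)
      exact mul_nonneg (mul_nonneg hβ0 hε1) (by linarith)
    linarith
  linarith

end Summit.QuantumFields.BalabanUV.Beta.EriceRemainderEnclosureHistoryAutonomyComparisonAgeCompositionDampedLevelGaugePrep

end
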